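import Summits.BirchSwinnertonDyer.Rank1Residual.Iwasawa.RankGrowthLayerHolds
import Literature.Barriers.BirchSwinnertonDyer.RankNotSumOfLocalInvariantsC3C3Proofs
import Literature.NumberTheory.EllipticCurves.AnalyticRankOverNumberFieldProofs
import HarnessLib

/-!
# Route T at layer 0: Mazur's main conjecture at an Eisenstein pair from the MORDELL–WEIL RANK over
# `ℚ` (any rank), binder-free in Greenberg Thm. 1.9
# (cell `bsd-eis`, `run/shared/lean/pub/bsd-eis/`; seat `bsd-eis-ky` gen 5, landing the planner's
# desk sketch `HOME/plan-g10/F6LayerZeroRank.lean` of FINDING F6; THEOREMS ONLY)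

HONEST FRAMING (FULL-BSD rank-≤1 programme D-0033, row A10-split: 83 census cells `(E₀, 3)`,
`r = 0`, split multiplicative Eisenstein `3`, `¬GVPar`). Nothing booked, no label moves.
`Iwasawa/RankGrowthLayerHolds.lean` gives `X2_mazurMainConjectureAt_of_layerRankGEAt'`: Mazur's main
conjecture at a multiplicative prime `p ≠ 2` with `E[p]` reducible from the analytic certificate
`(μ_an, λ_an) = (0, n)` and a rank-growth certificate `LayerRankGEAt W p k m` (`m ≤ rank E(ℚ_k)`) with
`n ≤ m` (non-split) / `n ≤ m + 1` (split), modulo Wuthrich 2014 Thm. 16 only. This file records the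
LAYER-0 instance: `m ≤ rank_ℤ E(ℚ)` already gives `LayerRankGEAt W p k m` for every `k` (the rank does
not drop under base change), hence the "λ-minimal" closing of `X2/LambdaMinimal.lean` WITHOUT the
Gross–Zagier–Kolyvagin input and WITHOUT `analyticRank ≤ 1` — in particular for RANK-2 (and higher)
curves, which the class-closure instruments list as `unknown-relative` (their MC tiers cover `r ≤ 1`).
Use (planner FINDINGS F6 / F9, road I): such a curve `E'` with `(μ_an, λ_an)(E', p) = (0, rank E'(ℚ) +
[split])` and a KERNEL certificate `2 ≤ rank E'(ℚ)` (`Literature.two_le_mordellWeilRank_of_redPair`) is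
a legitimate CLOSED RELATIVE for the route-G transfer
`X2.mazurMainConjectureAt_of_closedRelative_mult_of_facts` to a congruent (`E[p] ≅ E'[p]`) target.
THEOREMS ONLY; nothing about any particular curve is asserted; nothing booked.
-/

noncomputable section

open WeierstrassCurve Literature.NumberTheory.EllipticCurves
  Literature.NumberTheory.EllipticCurves.Wuthrich2014
  Summit.BirchSwinnertonDyer.Rank1Residual.X1.MuLambda
  Summit.BirchSwinnertonDyer.Rank1Residual.X1.ParitySqueeze

set_option autoImplicit false

namespace Summit.BirchSwinnertonDyer.Rank1Residual.Iwasawa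

variable (W : WeierstrassCurve ℚ) [W.IsElliptic] [W.IsGloballyMinimal] (p : ℕ) [Fact p.Prime]

omit [W.IsGloballyMinimal] in
/-- **The Mordell–Weil rank does not drop in the cyclotomic tower**: `m ≤ rank_ℤ E(ℚ)` gives the
rank-growth certificate `LayerRankGEAt W p k m` at EVERY layer `k` (`E(ℚ) ↪ E(ℚ_k)`; the tree's
`DokchitserDokchitser2011.mordellWeilRank_baseChange_le_of_algHom` with `WeierstrassCurve.baseChange_rat`,
as in `Theorems/Rank2ObservatoryRank3Exactness.lean`). [folklore] -/
theorem layerRankGEAt_of_le_mordellWeilRank {k m : ℕ} (hm : m ≤ W.mordellWeilRank) :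
    LayerRankGEAt W p k m := by
  intro κ _hκ
  haveI : FiniteDimensional ℚ (κ.layer k) := κ.finiteDimensional_layer_holds k
  haveI : NumberField (κ.layer k) := NumberField.of_module_finite ℚ (κ.layer k)
  have h := Literature.Barriers.BirchSwinnertonDyer.DokchitserDokchitser2011.mordellWeilRank_baseChange_le_of_algHom
    W (F := κ.layer k) (K := ℚ) (Algebra.ofId ℚ (κ.layer k))
  rw [WeierstrassCurve.baseChange_rat] at h
  exact hm.trans h

variable {W p}

/-- **Route T at layer 0 (X2, any rank, no parity, no GZK).** `W/ℚ` globally minimal elliptic,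
`p ≠ 2` multiplicative with `E[p]` reducible; granted Wuthrich 2014 Thm. 16 (`hWu`, PUBLISHED/TREE):
if `μ_an(E,p) = 0`, `λ_an(E,p) = n` (trivial zero included) and `m ≤ rank_ℤ E(ℚ)` with `n ≤ m`
(non-split) / `n ≤ m + 1` (split), then Mazur's main conjecture holds at `(E, p)`.
For `m = rank E(ℚ) = 2` at a split `p` this is the "rank-2 λ-minimal" case `(μ, λ) = (0, 3)`.
[cite: GreenbergLNM1716, Thm. 1.9 (p. 63)] [cite: Wuthrich2014, Thm. 16 (p. 397)] -/
theorem X2_mazurMainConjectureAt_of_le_mordellWeilRank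
    (hWu : thm16_charIdeal_dvd_multiplicative_of_reducible)
    (hp2 : p ≠ 2) (hmult : W.HasMultiplicativeReductionAtPrime p)
    (hred : ¬ W.HasIrreducibleModPGaloisRep p) {n m : ℕ}
    (hμ0 : X2.AnalyticMuLE W p 0) (hlam : X2.AnalyticLambdaEq W p n) (hm : m ≤ W.mordellWeilRank)
    (hkN : ¬ W.HasSplitMultiplicativeReductionAtPrime p → n ≤ m)
    (hkS : W.HasSplitMultiplicativeReductionAtPrime p → n ≤ m + 1) :
    X2.MazurMainConjectureAt W p :=
  X2_mazurMainConjectureAt_of_layerRankGEAt' hWu hp2 hmult hred hμ0 hlam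
    (layerRankGEAt_of_le_mordellWeilRank W p (k := 0) hm) hkN hkS

/-- **X1 twin (good ordinary anomalous, any rank).** [cite: GreenbergLNM1716, Thm. 1.9 (p. 63)]
[cite: Wuthrich2014, Thm. 16 (p. 397)] -/
theorem mazurMainConjecture_of_le_mordellWeilRank
    (hW16 : Wuthrich2014.charIdeal_dvd_padicLFunction)
    (hp : p ≠ 2) (hgood : W.HasGoodReductionAtPrime p) (hord : ¬ (p : ℤ) ∣ W.frobeniusTrace p)
    (hred : ¬ W.HasIrreducibleModPGaloisRep p) (hμ : X1.MuLambda.MuPartAt W p) {n m : ℕ}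
    (hlam : AnalyticLambdaEq W p n) (hm : m ≤ W.mordellWeilRank) (hnm : n ≤ m) :
    BirchSwinnertonDyer.Theorems.Rank1ResidualX1Defs.MazurMainConjecture W p :=
  mazurMainConjecture_of_layerRankGEAt' hW16 hp hgood hord hred hμ hlam
    (layerRankGEAt_of_le_mordellWeilRank W p (k := 0) hm) hnm

end Summit.BirchSwinnertonDyer.Rank1Residual.Iwasawa
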